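import Summits.CriticalPhenomena.PercolationContinuityZ3.Theorems.PercNearOneGluingNoHeavyLowerTailFrontierDecRowsRow44CutVertex
import Summits.CriticalPhenomena.PercolationContinuityZ3.Theorems.PercNearOneGluingNoHeavyLowerTailFrontierDecRowsFreeVertexSplit
import Mathlib.Tactic.Linarith
import HarnessLib

/-!
# Frontier dec row 44 `E₃(D[ab|cy], D[a|b], D[c|y])` across a cut vertex separating ONE terminal from the other three:
# the quadratic pencil, row 33, and the reduction to the three-terminal side

Support file for crux `stmt-CriticalPhenomena-4575` (master-family programme: the four-point decreasing `E₃` frontier,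
`…FrontierDecRowsLeFive` / `…LiteralDropping` / `…Row44CutVertex`), seat `prim-l12-p6` gen 15; memo
`run/shared/lean/prim/prim-l12/FROM-prim-l12-p6-g15-ROW44-CUT-VERTICES.md` §1.  No definitions, no named facts, no sorries.

Row 44 is `E₃(N, B, C)` with `N = D[ab|cy]`, `B = {a ≁ b}`, `C = {c ≁ y}` (one of the four independent open members
`15, 36, 37, 44` of the frontier for general `n`).  Gen 14 proved it across every cut vertex separating `{a,b}` from `{c,y}`
(`sahiE3_row44_nonneg_of_cutVertex`, Harris twice).  This file treats the cut vertices separating `{a,b,c}` from `{y}`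
(e.g. a PENDANT terminal `y`); by the dihedral symmetry of row 44 (`a ↔ b`, `c ↔ y`, `(a,b) ↔ (c,y)`) this is the general
`3 | 1` split.

THEOREM (`sahiE3_row44_nonneg_of_threeOneCut`).  Let `side : Fin n → Bool` colour the vertices, `a, b, c` on the `true` side,
`y` on the `false` side, and suppose every positive-weight edge `s(u,v)` with `u, v ≠ h` is monochromatic (so `h` is a cut vertex
separating `{a,b,c}` from `y`, or `y` is not joined to the rest at all).  If row 44 is non-negative at `(a,b,c,h)` (the lone
terminal replaced by the cut vertex), then it is non-negative at `(a,b,c,y)`.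

PROOF (the pencil in `ρ := P(h ↔ y on the y-side)` is QUADRATIC).  Thin to the support (`real_eq_real_setOf_inter_mem`) and glue the
two sides at `h` (`reachable_sup_iff_left/cross` of `…Row44CutVertex`).  With the side-1 (decreasing) events `D = {a≁c, b≁c}`,
`V = {a≁h, b≁h}`, `B = {a≁b}`, `W = {c≁h}` and the side-2 event `Y = {h ↔ y}`, `ρ = P(Y)`:
`N = D ∩ ¬(Vᶜ ∩ Y)`, `C = ¬(Wᶜ ∩ Y)`, and independence of the sides gives
`P(N) = d − (d − dv)ρ`, `P(NB) = db − (db − dvb)ρ`, `P(NC) = d − (d − dvw)ρ`, `P(NBC) = db − (db − dvbw)ρ`, `P(BC) = b − (b − bw)ρ`,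
`P(C) = 1 − (1 − w)ρ` (`d = P(D)`, `dv = P(D∩V)`, …).  Since `D ∩ Vᶜ ⊆ W` (if `h` is joined to `a` or `b` and `c` is not, then `c ≁ h`),
`P(D∩W) = dvw + d − dv` and `P(D∩B∩W) = dvbw + db − dvb`, and all cubic terms cancel:
  **`E₃(row 44 at (a,b,c,y)) = (1−ρ)²·Cov(D,B) + ρ(1−ρ)·[E₃(D,B,W) + Cov(D∩V,B)] + ρ²·E₃(D∩V,B,W)`**,
where `E₃(D,B,W)` is frontier row 33 at `(a,b,c,h)` (`frontier_33_all`, a kernel theorem for every `n`), `E₃(D∩V,B,W)` is row 44 at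
`(a,b,c,h)` (the hypothesis), and the two covariances of decreasing events are non-negative by Harris (`prodBernoulli_harris_lower`).  ∎
So, together with gen 14, a minimal counterexample to row 44 has no cut vertex whose removal separates the terminals as `2|2` of type
`{a,b}|{c,y}` or as `3|1`.
-/

noncomputable section

namespace Summit.CriticalPhenomena.PercolationContinuityZ3.Theorems.FrontierDecRows

open MeasureTheory CovTransferCert E3GroupSepCert
open Literature.Probability.Percolation Literature.Probability.LatticeModels

variable {n : ℕ}

/-- **Row 44 across a `3 | 1` cut vertex (e.g. a pendant terminal).**  If every positive-weight edge avoiding `h` joins two vertices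
of the same colour (`side`), with `a, b, c` coloured `true` and `y` coloured `false`, and row 44 is non-negative at `(a, b, c, h)`, then
`0 ≤ E₃(D[ab|cy], D[a|b], D[c|y])` at `(a, b, c, y)` under `prodBernoulli w`; exactly
`E₃ = (1−ρ)²·Cov(D,B) + ρ(1−ρ)·[E₃(row 33 at (a,b,c,h)) + Cov(D∩V,B)] + ρ²·E₃(row 44 at (a,b,c,h))` with `ρ = P(h ↔ y)`,
`D = D[ab|c]`, `V = D[ab|h]`, `B = D[a|b]` read on the three-terminal side. [this work] -/
theorem sahiE3_row44_nonneg_of_threeOneCut (w : Sym2 (Fin n) → unitInterval) (a b c y h : Fin n) (side : Fin n → Bool)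
    (ha : side a = true) (hb : side b = true) (hc : side c = true) (hy : side y = false)
    (hw : ∀ u v : Fin n, u ≠ h → v ≠ h → side u ≠ side v → w s(u, v) = 0)
    (h44 : 0 ≤ sahiE3 (prodBernoulli w) (connEvent (row 44 n (a, b, c, h)).1) (connEvent (row 44 n (a, b, c, h)).2.1)
      (connEvent (row 44 n (a, b, c, h)).2.2)) :
    0 ≤ sahiE3 (prodBernoulli w) (connEvent (row 44 n (a, b, c, y)).1) (connEvent (row 44 n (a, b, c, y)).2.1)
      (connEvent (row 44 n (a, b, c, y)).2.2) := by
  classical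
  -- row 33 at (a,b,c,h): a kernel theorem for every `n`
  have h33 := frontier_33_all w a b c h
  have hrow : row 44 n (a, b, c, y) = (sep [a, b] [c, y], sep [a] [b], sep [c] [y]) := rfl
  have hrow' : row 44 n (a, b, c, h) = (sep [a, b] [c, h], sep [a] [b], sep [c] [h]) := rfl
  have hrow33 : row 33 n (a, b, c, h) = (sep [a, b] [c], sep [a] [b], sep [c] [h]) := rfl
  simp only [hrow, connEvent_sep]
  simp only [hrow', connEvent_sep] at h44
  simp only [hrow33, connEvent_sep] at h33
  set μ := prodBernoulli w with hμ
  set N : Set (Set (Sym2 (Fin n))) := {ω | ∀ x ∈ [a, b], ∀ z ∈ [c, y], ω ∉ openConn x z} with hN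
  set B : Set (Set (Sym2 (Fin n))) := {ω | ∀ x ∈ [a], ∀ z ∈ [b], ω ∉ openConn x z} with hB
  set C : Set (Set (Sym2 (Fin n))) := {ω | ∀ x ∈ [c], ∀ z ∈ [y], ω ∉ openConn x z} with hC
  set N' : Set (Set (Sym2 (Fin n))) := {ω | ∀ x ∈ [a, b], ∀ z ∈ [c, h], ω ∉ openConn x z} with hN'
  set C' : Set (Set (Sym2 (Fin n))) := {ω | ∀ x ∈ [c], ∀ z ∈ [h], ω ∉ openConn x z} with hC'
  set X : Set (Set (Sym2 (Fin n))) := {ω | ∀ x ∈ [a, b], ∀ z ∈ [c], ω ∉ openConn x z} with hX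
  -- distinct terminals across the cut
  have hay : a ≠ y := fun e => by rw [e, hy] at ha; exact Bool.false_ne_true ha
  have hby : b ≠ y := fun e => by rw [e, hy] at hb; exact Bool.false_ne_true hb
  have hcy : c ≠ y := fun e => by rw [e, hy] at hc; exact Bool.false_ne_true hc
  -- the two edge sets
  set F₁ : Finset (Sym2 (Fin n)) := Finset.univ.filter (fun e => ∀ u ∈ e, side u = true ∨ u = h) with hF₁
  set F₂ : Finset (Sym2 (Fin n)) :=
    Finset.univ.filter (fun e => (∀ u ∈ e, side u = false ∨ u = h) ∧ ¬ ∀ u ∈ e, u = h) with hF₂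
  have mem₁ : ∀ e, e ∈ F₁ ↔ ∀ u ∈ e, side u = true ∨ u = h := fun e => by rw [hF₁, Finset.mem_filter]; simp
  have mem₂ : ∀ e, e ∈ F₂ ↔ (∀ u ∈ e, side u = false ∨ u = h) ∧ ¬ ∀ u ∈ e, u = h := fun e => by
    rw [hF₂, Finset.mem_filter]; simp
  have hdisj : Disjoint F₁ F₂ := by
    rw [Finset.disjoint_left]
    intro e h1 h2
    rw [mem₁] at h1; rw [mem₂] at h2
    apply h2.2
    intro u hu
    rcases h1 u hu with h1 | h1
    · rcases h2.1 u hu with h2 | h2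
      · rw [h1] at h2; exact absurd h2 (by decide)
      · exact h2
    · exact h1
  set D : Finset (Sym2 (Fin n)) := F₁ ∪ F₂ with hD
  have hwD : ∀ e, e ∉ D → w e = 0 := by
    intro e he
    rw [hD, Finset.mem_union, not_or, mem₁, mem₂] at he
    obtain ⟨h1, h2⟩ := he
    induction e using Sym2.ind with
    | h u v =>
      have key : u ≠ h ∧ v ≠ h ∧ side u ≠ side v := by
        by_cases hu : u = h
        · subst hu
          exfalso
          by_cases hv : v = u
          · exact h1 fun x hx => Or.inr (by rcases Sym2.mem_iff.1 hx with e | e <;> [exact e; exact e.trans hv])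
          · cases hsv : side v
            · exact h2 ⟨fun x hx => by rcases Sym2.mem_iff.1 hx with e | e <;> [exact Or.inr e; exact Or.inl (e ▸ hsv)],
                fun hall => hv (hall v (Sym2.mem_iff.2 (Or.inr rfl)))⟩
            · exact h1 fun x hx => by rcases Sym2.mem_iff.1 hx with e | e <;> [exact Or.inr e; exact Or.inl (e ▸ hsv)]
        · by_cases hv : v = h
          · subst hv
            exfalso
            cases hsu : side u
            · exact h2 ⟨fun x hx => by rcases Sym2.mem_iff.1 hx with e | e <;> [exact Or.inl (e ▸ hsu); exact Or.inr e],
                fun hall => hu (hall u (Sym2.mem_iff.2 (Or.inl rfl)))⟩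
            · exact h1 fun x hx => by rcases Sym2.mem_iff.1 hx with e | e <;> [exact Or.inl (e ▸ hsu); exact Or.inr e]
          · refine ⟨hu, hv, fun hse => ?_⟩
            cases hsu : side u
            · exact h2 ⟨fun x hx => by
                  rcases Sym2.mem_iff.1 hx with e | e <;> [exact Or.inl (e ▸ hsu); exact Or.inl (e ▸ (hse ▸ hsu))],
                fun hall => hu (hall u (Sym2.mem_iff.2 (Or.inl rfl)))⟩
            · exact h1 fun x hx => by
                rcases Sym2.mem_iff.1 hx with e | e <;> [exact Or.inl (e ▸ hsu); exact Or.inl (e ▸ (hse ▸ hsu))]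
      exact hw u v key.1 key.2.1 key.2.2
  -- side graphs of a configuration
  have hT : ∀ ω : Set (Sym2 (Fin n)), ∀ v u u', (openGraph (ω ∩ ↑F₁)).Adj v u → (openGraph (ω ∩ ↑F₂)).Adj v u' → v = h := by
    intro ω v u u' h1 h2
    rw [openGraph_adj] at h1 h2
    have e1 := (mem₁ _).1 (Finset.mem_coe.1 h1.1.2) v (Sym2.mem_iff.2 (Or.inl rfl))
    have e2 := ((mem₂ _).1 (Finset.mem_coe.1 h2.1.2)).1 v (Sym2.mem_iff.2 (Or.inl rfl))
    rcases e1 with e1 | e1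
    · rcases e2 with e2 | e2
      · rw [e1] at e2; exact absurd e2 (by decide)
      · exact e2
    · exact e1
  have iso₂ : ∀ ω : Set (Sym2 (Fin n)), ∀ x, side x = true → x ≠ h → ∀ u, ¬ (openGraph (ω ∩ ↑F₂)).Adj x u := by
    intro ω x hx hxh u hadj
    rw [openGraph_adj] at hadj
    rcases ((mem₂ _).1 (Finset.mem_coe.1 hadj.1.2)).1 x (Sym2.mem_iff.2 (Or.inl rfl)) with e | e
    · rw [hx] at e; exact Bool.noConfusion e
    · exact hxh e
  have iso₁ : ∀ ω : Set (Sym2 (Fin n)), ∀ x, side x = false → x ≠ h → ∀ u, ¬ (openGraph (ω ∩ ↑F₁)).Adj x u := by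
    intro ω x hx hxh u hadj
    rw [openGraph_adj] at hadj
    rcases (mem₁ _).1 (Finset.mem_coe.1 hadj.1.2) x (Sym2.mem_iff.2 (Or.inl rfl)) with e | e
    · rw [hx] at e; exact Bool.noConfusion e
    · exact hxh e
  have isoH : ∀ ω : Set (Sym2 (Fin n)), h ≠ h → ∀ u, ¬ (openGraph (ω ∩ ↑F₂)).Adj h u := fun ω hh => absurd rfl hh
  have hsup : ∀ ω : Set (Sym2 (Fin n)), openGraph (ω ∩ ↑D) = openGraph (ω ∩ ↑F₁) ⊔ openGraph (ω ∩ ↑F₂) := by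
    intro ω
    rw [hD, Finset.coe_union, Set.inter_union_distrib_left]
    exact SimpleGraph.fromEdgeSet_union _ _
  -- same-side pairs among {a, b, c, h} and the cross pairs towards y, on the thinned configuration
  have pl : ∀ ω : Set (Sym2 (Fin n)), ∀ x z, side x = true → side z = true →
      ((openGraph (ω ∩ ↑D)).Reachable x z ↔ (openGraph (ω ∩ ↑F₁)).Reachable x z) := by
    intro ω x z hx hz
    rw [hsup ω]
    exact reachable_sup_iff_left (hT ω) (iso₂ ω x hx) (iso₂ ω z hz)
  have plh : ∀ ω : Set (Sym2 (Fin n)), ∀ x, side x = true →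
      ((openGraph (ω ∩ ↑D)).Reachable x h ↔ (openGraph (ω ∩ ↑F₁)).Reachable x h) := by
    intro ω x hx
    rw [hsup ω]
    exact reachable_sup_iff_left (hT ω) (iso₂ ω x hx) (isoH ω)
  have pc : ∀ ω : Set (Sym2 (Fin n)), ∀ x, side x = true → x ≠ y →
      ((openGraph (ω ∩ ↑D)).Reachable x y ↔
        (openGraph (ω ∩ ↑F₁)).Reachable x h ∧ (openGraph (ω ∩ ↑F₂)).Reachable h y) := by
    intro ω x hx hxy
    rw [hsup ω]
    exact reachable_sup_iff_cross (hT ω) (iso₂ ω x hx) (iso₁ ω y hy) hxy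
  -- thinned side events
  set ED : Set (Set (Sym2 (Fin n))) := {ω | ω ∩ ↑F₁ ∈ ((openConn a c)ᶜ ∩ (openConn b c)ᶜ : Set (Set (Sym2 (Fin n))))}
    with hED
  set EB : Set (Set (Sym2 (Fin n))) := {ω | ω ∩ ↑F₁ ∈ ((openConn a b)ᶜ : Set (Set (Sym2 (Fin n))))} with hEB
  set EV : Set (Set (Sym2 (Fin n))) := {ω | ω ∩ ↑F₁ ∈ ((openConn a h)ᶜ ∩ (openConn b h)ᶜ : Set (Set (Sym2 (Fin n))))}
    with hEV
  set EW : Set (Set (Sym2 (Fin n))) := {ω | ω ∩ ↑F₁ ∈ ((openConn c h)ᶜ : Set (Set (Sym2 (Fin n))))} with hEW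
  set EY : Set (Set (Sym2 (Fin n))) := {ω | ω ∩ ↑F₂ ∈ (openConn h y : Set (Set (Sym2 (Fin n))))} with hEY
  -- translation of the events (target row and the two hypothesis rows)
  have tB : {ω : Set (Sym2 (Fin n)) | ω ∩ ↑D ∈ B} = EB := by
    ext ω
    simp only [hB, hEB, Set.mem_setOf_eq, List.mem_singleton, forall_eq, Set.mem_compl_iff, openConn]
    exact not_congr (pl ω a b ha hb)
  have tX : {ω : Set (Sym2 (Fin n)) | ω ∩ ↑D ∈ X} = ED := by
    ext ω
    simp only [hX, hED, Set.mem_setOf_eq, Set.mem_inter_iff, Set.mem_compl_iff, openConn, List.mem_cons, List.mem_nil_iff,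
      or_false, forall_eq_or_imp, forall_eq]
    rw [pl ω a c ha hc, pl ω b c hb hc]
  have tC' : {ω : Set (Sym2 (Fin n)) | ω ∩ ↑D ∈ C'} = EW := by
    ext ω
    simp only [hC', hEW, Set.mem_setOf_eq, List.mem_singleton, forall_eq, Set.mem_compl_iff, openConn]
    exact not_congr (plh ω c hc)
  have tN' : {ω : Set (Sym2 (Fin n)) | ω ∩ ↑D ∈ N'} = ED ∩ EV := by
    ext ω
    simp only [hN', hED, hEV, Set.mem_setOf_eq, Set.mem_inter_iff, Set.mem_compl_iff, openConn, List.mem_cons,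
      List.mem_nil_iff, or_false, forall_eq_or_imp, forall_eq]
    rw [pl ω a c ha hc, plh ω a ha, pl ω b c hb hc, plh ω b hb]
    tauto
  have tC : {ω : Set (Sym2 (Fin n)) | ω ∩ ↑D ∈ C} = (EWᶜ ∩ EY)ᶜ := by
    ext ω
    simp only [hC, hEW, hEY, Set.mem_setOf_eq, List.mem_singleton, forall_eq, Set.mem_compl_iff, Set.mem_inter_iff,
      openConn]
    rw [pc ω c hc hcy]
    tauto
  have tN : {ω : Set (Sym2 (Fin n)) | ω ∩ ↑D ∈ N} = ED ∩ (EVᶜ ∩ EY)ᶜ := by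
    ext ω
    simp only [hN, hED, hEV, hEY, Set.mem_setOf_eq, Set.mem_compl_iff, Set.mem_inter_iff, openConn, List.mem_cons,
      List.mem_nil_iff, or_false, forall_eq_or_imp, forall_eq]
    rw [pl ω a c ha hc, pc ω a ha hay, pl ω b c hb hc, pc ω b hb hby]
    tauto
  -- preimages commute with the set operations (definitional)
  have pre_inter : ∀ P Q : Set (Set (Sym2 (Fin n))),
      {ω : Set (Sym2 (Fin n)) | ω ∩ ↑D ∈ P ∩ Q} = {ω | ω ∩ ↑D ∈ P} ∩ {ω | ω ∩ ↑D ∈ Q} := fun P Q => rfl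
  have thin : ∀ A : Set (Set (Sym2 (Fin n))), μ.real A = μ.real {ω | ω ∩ ↑D ∈ A} :=
    fun A => real_eq_real_setOf_inter_mem w D hwD A
  have ms : ∀ A : Set (Set (Sym2 (Fin n))), MeasurableSet A := fun A => (Set.toFinite _).measurableSet
  -- the inclusion `D ∩ Vᶜ ⊆ W` on the three-terminal side
  have incl : ED ∩ EVᶜ ⊆ EW := by
    intro ω hω
    simp only [hED, hEV, hEW, Set.mem_inter_iff, Set.mem_setOf_eq, Set.mem_compl_iff, openConn, not_and, not_not] at hω ⊢
    obtain ⟨⟨hac, hbc⟩, hv⟩ := hω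
    intro hch
    by_cases hah : (openGraph (ω ∩ ↑F₁)).Reachable a h
    · exact hac (hah.trans hch.symm)
    · exact hbc ((hv hah).trans hch.symm)
  -- independence of the two sides
  have detY : DeterminedBy EY (↑F₁ : Set (Sym2 (Fin n)))ᶜ := by
    rw [determinedBy_iff]
    intro ω ω' hω
    have hsub : (↑F₂ : Set (Sym2 (Fin n))) ⊆ (↑F₁ : Set (Sym2 (Fin n)))ᶜ := fun e he he1 =>
      Finset.disjoint_left.1 hdisj (Finset.mem_coe.1 he1) (Finset.mem_coe.1 he)
    have : ω ∩ ↑F₂ = ω' ∩ ↑F₂ := by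
      rw [← Set.inter_eq_self_of_subset_right hsub, ← Set.inter_assoc, ← Set.inter_assoc, hω]
    simp only [hEY, Set.mem_setOf_eq, this]
  have indep : ∀ S : Set (Set (Sym2 (Fin n))), (∀ ω ω' : Set (Sym2 (Fin n)), ω ∩ ↑F₁ = ω' ∩ ↑F₁ → (ω ∈ S ↔ ω' ∈ S)) →
      μ.real (S ∩ EY) = μ.real S * μ.real EY :=
    fun S hS => prodBernoulli_real_inter_of_determinedBy w F₁ ((determinedBy_iff S _).2 hS) detY (ms _) (ms _)
  -- the two linear relations from `incl`
  have rel1 : μ.real (ED ∩ EW) = μ.real (ED ∩ EV ∩ EW) + (μ.real ED - μ.real (ED ∩ EV)) := by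
    have e1 : (ED ∩ EW) \ (ED ∩ EV ∩ EW) = ED \ (ED ∩ EV) := by
      ext ω
      simp only [Set.mem_sdiff, Set.mem_inter_iff]
      constructor
      · rintro ⟨⟨hD', hW'⟩, hn⟩; exact ⟨hD', fun h2 => hn ⟨⟨hD', h2.2⟩, hW'⟩⟩
      · rintro ⟨hD', hn⟩
        have hV : ω ∉ EV := fun hv => hn ⟨hD', hv⟩
        exact ⟨⟨hD', incl ⟨hD', hV⟩⟩, fun h2 => hn ⟨hD', h2.1.2⟩⟩
    have m1 : μ.real ((ED ∩ EW) \ (ED ∩ EV ∩ EW)) = μ.real (ED ∩ EW) - μ.real (ED ∩ EV ∩ EW) :=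
      measureReal_sdiff (by intro ω hω; exact ⟨hω.1.1, hω.2⟩) (ms _)
    have m2 : μ.real (ED \ (ED ∩ EV)) = μ.real ED - μ.real (ED ∩ EV) :=
      measureReal_sdiff (by intro ω hω; exact hω.1) (ms _)
    rw [e1] at m1
    linarith
  have rel2 : μ.real (ED ∩ EB ∩ EW) = μ.real (ED ∩ EV ∩ EB ∩ EW) + (μ.real (ED ∩ EB) - μ.real (ED ∩ EV ∩ EB)) := by
    have e1 : (ED ∩ EB ∩ EW) \ (ED ∩ EV ∩ EB ∩ EW) = (ED ∩ EB) \ (ED ∩ EV ∩ EB) := by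
      ext ω
      simp only [Set.mem_sdiff, Set.mem_inter_iff]
      constructor
      · rintro ⟨⟨⟨hD', hB'⟩, hW'⟩, hn⟩; exact ⟨⟨hD', hB'⟩, fun h2 => hn ⟨⟨⟨hD', h2.1.2⟩, hB'⟩, hW'⟩⟩
      · rintro ⟨⟨hD', hB'⟩, hn⟩
        have hV : ω ∉ EV := fun hv => hn ⟨⟨hD', hv⟩, hB'⟩
        exact ⟨⟨⟨hD', hB'⟩, incl ⟨hD', hV⟩⟩, fun h2 => hn ⟨⟨hD', h2.1.1.2⟩, hB'⟩⟩
    have m1 : μ.real ((ED ∩ EB ∩ EW) \ (ED ∩ EV ∩ EB ∩ EW)) = μ.real (ED ∩ EB ∩ EW) - μ.real (ED ∩ EV ∩ EB ∩ EW) :=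
      measureReal_sdiff (by intro ω hω; exact ⟨⟨hω.1.1.1, hω.1.2⟩, hω.2⟩) (ms _)
    have m2 : μ.real ((ED ∩ EB) \ (ED ∩ EV ∩ EB)) = μ.real (ED ∩ EB) - μ.real (ED ∩ EV ∩ EB) :=
      measureReal_sdiff (by intro ω hω; exact ⟨hω.1.1, hω.2⟩) (ms _)
    rw [e1] at m1
    linarith
  -- the hypothesis rows in atoms
  have q33 : sahiE3 μ X B C' = 2 * μ.real (ED ∩ EB ∩ EW) + μ.real ED * μ.real EB * μ.real EW -
      (μ.real ED * μ.real (EB ∩ EW) + μ.real EB * μ.real (ED ∩ EW) + μ.real EW * μ.real (ED ∩ EB)) := by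
    rw [sahiE3_def, thin (X ∩ B ∩ C'), thin X, thin B, thin C', thin (B ∩ C'), thin (X ∩ C'), thin (X ∩ B)]
    simp only [pre_inter, tX, tB, tC']
  have q44 : sahiE3 μ N' B C' = 2 * μ.real (ED ∩ EV ∩ EB ∩ EW) + μ.real (ED ∩ EV) * μ.real EB * μ.real EW -
      (μ.real (ED ∩ EV) * μ.real (EB ∩ EW) + μ.real EB * μ.real (ED ∩ EV ∩ EW) + μ.real EW * μ.real (ED ∩ EV ∩ EB)) := by
    rw [sahiE3_def, thin (N' ∩ B ∩ C'), thin N', thin B, thin C', thin (B ∩ C'), thin (N' ∩ C'), thin (N' ∩ B)]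
    simp only [pre_inter, tN', tB, tC']
  -- the target row in atoms (`ρ = μ.real EY`)
  have eNBC : μ.real (N ∩ B ∩ C) = μ.real (ED ∩ EB) - (μ.real (ED ∩ EB) - μ.real (ED ∩ EV ∩ EB ∩ EW)) * μ.real EY := by
    rw [thin, pre_inter, pre_inter, tN, tB, tC]
    have e : ED ∩ (EVᶜ ∩ EY)ᶜ ∩ EB ∩ (EWᶜ ∩ EY)ᶜ = (ED ∩ EB) \ (((ED ∩ EB) \ (ED ∩ EV ∩ EB ∩ EW)) ∩ EY) := by
      ext ω; simp only [Set.mem_inter_iff, Set.mem_compl_iff, Set.mem_sdiff]; tauto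
    have i1 := indep ((ED ∩ EB) \ (ED ∩ EV ∩ EB ∩ EW)) (by
      intro ω ω' hω; simp only [hED, hEB, hEV, hEW, Set.mem_setOf_eq, Set.mem_inter_iff, Set.mem_sdiff, hω])
    rw [e, measureReal_sdiff (by intro ω hω; exact hω.1.1) (ms _), i1,
      measureReal_sdiff (by intro ω hω; exact ⟨hω.1.1.1, hω.1.2⟩) (ms _)]
  have eNB : μ.real (N ∩ B) = μ.real (ED ∩ EB) - (μ.real (ED ∩ EB) - μ.real (ED ∩ EV ∩ EB)) * μ.real EY := by
    rw [thin, pre_inter, tN, tB]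
    have e : ED ∩ (EVᶜ ∩ EY)ᶜ ∩ EB = (ED ∩ EB) \ (((ED ∩ EB) \ (ED ∩ EV ∩ EB)) ∩ EY) := by
      ext ω; simp only [Set.mem_inter_iff, Set.mem_compl_iff, Set.mem_sdiff]; tauto
    have i1 := indep ((ED ∩ EB) \ (ED ∩ EV ∩ EB)) (by
      intro ω ω' hω; simp only [hED, hEB, hEV, Set.mem_setOf_eq, Set.mem_inter_iff, Set.mem_sdiff, hω])
    rw [e, measureReal_sdiff (by intro ω hω; exact hω.1.1) (ms _), i1,
      measureReal_sdiff (by intro ω hω; exact ⟨hω.1.1, hω.2⟩) (ms _)]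
  have eNC : μ.real (N ∩ C) = μ.real ED - (μ.real ED - μ.real (ED ∩ EV ∩ EW)) * μ.real EY := by
    rw [thin, pre_inter, tN, tC]
    have e : ED ∩ (EVᶜ ∩ EY)ᶜ ∩ (EWᶜ ∩ EY)ᶜ = ED \ ((ED \ (ED ∩ EV ∩ EW)) ∩ EY) := by
      ext ω; simp only [Set.mem_inter_iff, Set.mem_compl_iff, Set.mem_sdiff]; tauto
    have i1 := indep (ED \ (ED ∩ EV ∩ EW)) (by
      intro ω ω' hω; simp only [hED, hEV, hEW, Set.mem_setOf_eq, Set.mem_inter_iff, Set.mem_sdiff, hω])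
    rw [e, measureReal_sdiff (by intro ω hω; exact hω.1.1) (ms _), i1,
      measureReal_sdiff (by intro ω hω; exact hω.1.1) (ms _)]
  have eN : μ.real N = μ.real ED - (μ.real ED - μ.real (ED ∩ EV)) * μ.real EY := by
    rw [thin, tN]
    have e : ED ∩ (EVᶜ ∩ EY)ᶜ = ED \ ((ED \ (ED ∩ EV)) ∩ EY) := by
      ext ω; simp only [Set.mem_inter_iff, Set.mem_compl_iff, Set.mem_sdiff]; tauto
    have i1 := indep (ED \ (ED ∩ EV)) (by
      intro ω ω' hω; simp only [hED, hEV, Set.mem_setOf_eq, Set.mem_inter_iff, Set.mem_sdiff, hω])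
    rw [e, measureReal_sdiff (by intro ω hω; exact hω.1.1) (ms _), i1,
      measureReal_sdiff (by intro ω hω; exact hω.1) (ms _)]
  have eBC : μ.real (B ∩ C) = μ.real EB - (μ.real EB - μ.real (EB ∩ EW)) * μ.real EY := by
    rw [thin, pre_inter, tB, tC]
    have e : EB ∩ (EWᶜ ∩ EY)ᶜ = EB \ ((EB \ (EB ∩ EW)) ∩ EY) := by
      ext ω; simp only [Set.mem_inter_iff, Set.mem_compl_iff, Set.mem_sdiff]; tauto
    have i1 := indep (EB \ (EB ∩ EW)) (by
      intro ω ω' hω; simp only [hEB, hEW, Set.mem_setOf_eq, Set.mem_inter_iff, Set.mem_sdiff, hω])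
    rw [e, measureReal_sdiff (by intro ω hω; exact hω.1.1) (ms _), i1,
      measureReal_sdiff (by intro ω hω; exact hω.1) (ms _)]
  have eC : μ.real C = 1 - (1 - μ.real EW) * μ.real EY := by
    rw [thin, tC]
    have e : (EWᶜ ∩ EY)ᶜ = Set.univ \ ((Set.univ \ EW) ∩ EY) := by
      ext ω; simp only [Set.mem_inter_iff, Set.mem_compl_iff, Set.mem_sdiff, Set.mem_univ, true_and]
    have i1 := indep (Set.univ \ EW) (by
      intro ω ω' hω; simp only [hEW, Set.mem_setOf_eq, Set.mem_sdiff, Set.mem_univ, hω])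
    rw [e, measureReal_sdiff (Set.subset_univ _) (ms _), i1, measureReal_sdiff (Set.subset_univ _) (ms _)]
    simp [hμ]
  have eB : μ.real B = μ.real EB := by rw [thin, tB]
  -- Harris on the three-terminal side (decreasing × decreasing)
  have loConn : ∀ u v : Fin n,
      IsLowerSet {ω : Set (Sym2 (Fin n)) | ω ∩ ↑F₁ ∈ ((openConn u v)ᶜ : Set (Set (Sym2 (Fin n))))} := by
    intro u v ω ω' hle hω
    simp only [Set.mem_setOf_eq, Set.mem_compl_iff] at hω ⊢
    exact fun h' => hω (isUpperSet_openConn u v (Set.inter_subset_inter_left _ hle) h')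
  have loED : IsLowerSet ED := by
    have : ED = {ω : Set (Sym2 (Fin n)) | ω ∩ ↑F₁ ∈ ((openConn a c)ᶜ : Set (Set (Sym2 (Fin n))))} ∩
        {ω | ω ∩ ↑F₁ ∈ ((openConn b c)ᶜ : Set (Set (Sym2 (Fin n))))} := rfl
    rw [this]; exact (loConn a c).inter (loConn b c)
  have loEV : IsLowerSet EV := by
    have : EV = {ω : Set (Sym2 (Fin n)) | ω ∩ ↑F₁ ∈ ((openConn a h)ᶜ : Set (Set (Sym2 (Fin n))))} ∩
        {ω | ω ∩ ↑F₁ ∈ ((openConn b h)ᶜ : Set (Set (Sym2 (Fin n))))} := rfl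
    rw [this]; exact (loConn a h).inter (loConn b h)
  have loEB : IsLowerSet EB := loConn a b
  have harrisDB : μ.real ED * μ.real EB ≤ μ.real (ED ∩ EB) := prodBernoulli_harris_lower w loED loEB (ms _) (ms _)
  have harrisDVB : μ.real (ED ∩ EV) * μ.real EB ≤ μ.real (ED ∩ EV ∩ EB) :=
    prodBernoulli_harris_lower w (loED.inter loEV) loEB (ms _) (ms _)
  -- `ρ ∈ [0,1]`
  have hρ0 : 0 ≤ μ.real EY := measureReal_nonneg
  have hρ1 : μ.real EY ≤ 1 :=
    (measureReal_mono (Set.subset_univ EY)).trans (le_of_eq (by simp [hμ]))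
  -- the identity and the conclusion
  have key : sahiE3 μ N B C =
      (1 - μ.real EY) ^ 2 * (μ.real (ED ∩ EB) - μ.real ED * μ.real EB) +
        μ.real EY * (1 - μ.real EY) * (sahiE3 μ X B C' + (μ.real (ED ∩ EV ∩ EB) - μ.real (ED ∩ EV) * μ.real EB)) +
        μ.real EY ^ 2 * sahiE3 μ N' B C' := by
    rw [sahiE3_def, eNBC, eN, eB, eC, eBC, eNC, eNB, q33, q44, rel1, rel2]
    ring
  rw [key]
  have t1 : 0 ≤ (1 - μ.real EY) ^ 2 * (μ.real (ED ∩ EB) - μ.real ED * μ.real EB) :=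
    mul_nonneg (sq_nonneg _) (sub_nonneg.2 harrisDB)
  have t2 : 0 ≤ μ.real EY * (1 - μ.real EY) *
      (sahiE3 μ X B C' + (μ.real (ED ∩ EV ∩ EB) - μ.real (ED ∩ EV) * μ.real EB)) :=
    mul_nonneg (mul_nonneg hρ0 (sub_nonneg.2 hρ1)) (add_nonneg h33 (sub_nonneg.2 harrisDVB))
  have t3 : 0 ≤ μ.real EY ^ 2 * sahiE3 μ N' B C' := mul_nonneg (sq_nonneg _) h44
  linarith

end Summit.CriticalPhenomena.PercolationContinuityZ3.Theorems.FrontierDecRows
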